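import Summits.KontsevichZagierPeriods.KontsevichZagierPeriods.Theses.TorsionLogs
import Summits.KontsevichZagierPeriods.KontsevichZagierPeriods.Theorems.TorsionLogsNeronTorsionSector

/-!
# F3 WITNESS for the rung `NeronTorsionComplexPoints` (line `NeronTorsionComplex` on crux `TorsionSectorComplete`,
# stmt-KontsevichZagierPeriods-14212; forward generator G1, seed g1-KontsevichZagierPeriods-17981)

The rung is the Bool-indexed family `NeronTorsionPointSector` (member `false` = a REAL torsion point on the identity
component = `Theses.TorsionLogs.NeronTorsionSector` VERBATIM; member `true` = a NON-REAL torsion point of the real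
curve), `NeronTorsionComplexPoints := ∀ nonReal, …`.  The floor specialises the rung at `nonReal = false`: the seed
theorem `Cruxes.NeronTorsionSector.Translation.stub_assembly` (item stmt-KontsevichZagierPeriods-17981,
`NeronTorsionPrimitiveChain`) through the landed bookkeeping `NeronTorsionSector_of_primitiveChain` IS member `false`
(`Iff.rfl`).  No `sorry`.  Self-contained: verbatim copies of the two `def`s of `Lines/NeronTorsionComplex.lean` in
the namespace `…NeronTorsionComplex.Special` (the skeleton module proves the same fact about the registered decl as
`neronTorsionPointSector_false`). [cite: KontsevichZagier2001, §1.2]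
-/

noncomputable section

-- `Summit.KontsevichZagierPeriods.KontsevichZagierPeriods.…` is the tree's mandated layout (single-conjunct summit).
set_option linter.dupNamespace false

namespace Summit.KontsevichZagierPeriods.KontsevichZagierPeriods.Cruxes.TorsionSectorComplete.NeronTorsionComplex.Special
open Summit.KontsevichZagierPeriods.KontsevichZagierPeriods.Cruxes.NeronTorsionSector.Translation
  (NeronTorsionSector_of_primitiveChain stub_assembly NeronTorsionSector_of)

/-- Verbatim copy of `Lines/NeronTorsionComplex.lean :: NeronTorsionPointSector`. -/
def NeronTorsionPointSector : Bool → Prop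
  | false => ∀ (g₂ g₃ e₁ xP yP α : ℝ) (N a : ℕ) (M k m : ℤ) (f : ℝ → ℝ), (∀ x, f x = 4 * x ^ 3 - g₂ * x - g₃) → g₂ ^ 3 - 27 * g₃ ^ 2 ≠ 0 → f e₁ = 0 → 0 < e₁ → (∀ x, e₁ < x → 0 < f x) → e₁ < xP → yP ^ 2 = f xP → 3 ≤ N → 0 < a → 2 * a < N → 4 * (N : ℤ) ^ 2 * k = M * ((N : ℤ) - 2 * (a : ℤ)) ^ 2 → (∀ hns : (⟨0, 0, 0, -g₂ / 4, -g₃ / 4⟩ : WeierstrassCurve ℝ).toAffine.Nonsingular xP (yP / 2), addOrderOf (WeierstrassCurve.Affine.Point.some xP (yP / 2) hns) = N) → (N : ℝ) * (∫ x in Set.Ioi xP, (Real.sqrt (f x))⁻¹) = a * (2 * ∫ x in Set.Ioi e₁, (Real.sqrt (f x))⁻¹) → 1 < α → ∀ (rI rP : Literature.NumberTheory.Transcendental.KZ.IntegralRep 2) (rL : Literature.NumberTheory.Transcendental.KZ.IntegralRep 1), rI.domain = {z | e₁ < z 1 ∧ z 1 < z 0 ∧ z 0 < xP} → Set.EqOn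 rI.integrand (fun z => z 1 / (Real.sqrt (f (z 1)) * Real.sqrt (f (z 0)))) rI.domain → rP.domain = {z | e₁ < z 0 ∧ e₁ < z 1} → Set.EqOn rP.integrand (fun z => (Real.sqrt (f (z 0)))⁻¹ * ((g₂ * z 1 + 2 * g₃) / (2 * (z 1) ^ 2 * Real.sqrt (f (z 1))))) rP.domain → rL.domain = {t | 1 < t 0 ∧ t 0 < α} → Set.EqOn rL.integrand (fun t => (t 0)⁻¹) rL.domain → (M : ℝ) * rI.value + k * rP.value = m * rL.value → M • Literature.NumberTheory.Transcendental.KZ.of rI + k • Literature.NumberTheory.Transcendental.KZ.of rP - m • Literature.NumberTheory.Transcendental.KZ.of rL ∈ Literature.NumberTheory.Transcendental.KZ.relations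
  | true => ∀ (g₂ g₃ e₁ e₂ α : ℝ) (xP yP : ℂ) (yc : ℝ → ℂ) (N a b : ℕ) (M k₁ k₂ m : ℤ) (f : ℝ → ℝ), (∀ x, f x = 4 * x ^ 3 - g₂ * x - g₃) → g₂ ^ 3 - 27 * g₃ ^ 2 ≠ 0 → f e₁ = 0 → f e₂ = 0 → e₂ < e₁ → 0 < e₁ → (∀ x, e₁ < x → 0 < f x) → (∀ x, e₂ < x → x < e₁ → f x < 0) → xP.im ≠ 0 → yP ^ 2 = 4 * xP ^ 3 - (g₂ : ℂ) * xP - (g₃ : ℂ) → ContinuousOn yc (Set.Icc 0 1) → yc 1 = yP → (∀ s ∈ Set.Icc (0 : ℝ) 1, yc s ^ 2 = 4 * ((e₁ : ℂ) + (s : ℂ) * (xP - e₁)) ^ 3 - (g₂ : ℂ) * ((e₁ : ℂ) + (s : ℂ) * (xP - e₁)) - (g₃ : ℂ)) → (∀ s ∈ Set.Ioc (0 : ℝ) 1, yc s ≠ 0) → 3 ≤ N → 0 < a → 2 * a < N → 0 < b → 2 * b < N → (N : ℂ) * (((∫ x in Set.Ioi e₁, (Real.sqrt (f x))⁻¹ :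 ℝ) : ℂ) + ∫ s in Set.Ioo (0 : ℝ) 1, (xP - e₁) / yc s) = (a : ℂ) * (((2 * ∫ x in Set.Ioi e₁, (Real.sqrt (f x))⁻¹ : ℝ) : ℂ)) + (b : ℂ) * (((2 * ∫ x in Set.Ioo e₂ e₁, (Real.sqrt (-f x))⁻¹ : ℝ) : ℂ)) * Complex.I → 4 * (N : ℤ) ^ 2 * k₁ = M * ((N : ℤ) - 2 * (a : ℤ)) ^ 2 → (N : ℤ) ^ 2 * k₂ = 2 * M * (b : ℤ) ^ 2 → 1 < α → ∀ (rI rP rQ : Literature.NumberTheory.Transcendental.KZ.IntegralRep 2) (rL : Literature.NumberTheory.Transcendental.KZ.IntegralRep 1), rI.domain = {z | 0 < z 1 ∧ z 1 < z 0 ∧ z 0 < 1} → Set.EqOn rI.integrand (fun z => ((xP - e₁) ^ 2 * ((e₁ : ℂ) + ((z 1 : ℝ) : ℂ) * (xP - e₁)) / (yc (z 1) * yc (z 0))).re) rI.domain → rP.domain = {z | e₁ < z 0 ∧ e₁ < z 1} → Set.EqOn rP.integrand (fun z => (Real.sqrt (f (z 0)))⁻¹ * ((g₂ * z 1 + 2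 * g₃) / (2 * (z 1) ^ 2 * Real.sqrt (f (z 1))))) rP.domain → rQ.domain = {z | e₂ < z 0 ∧ z 0 < e₁ ∧ e₂ < z 1 ∧ z 1 < e₁} → Set.EqOn rQ.integrand (fun z => (Real.sqrt (-f (z 0)))⁻¹ * (z 1 / Real.sqrt (-f (z 1)))) rQ.domain → rL.domain = {t | 1 < t 0 ∧ t 0 < α} → Set.EqOn rL.integrand (fun t => (t 0)⁻¹) rL.domain → (M : ℝ) * rI.value + k₁ * rP.value + k₂ * rQ.value = m * rL.value → M • Literature.NumberTheory.Transcendental.KZ.of rI + k₁ • Literature.NumberTheory.Transcendental.KZ.of rP + k₂ • Literature.NumberTheory.Transcendental.KZ.of rQ - m • Literature.NumberTheory.Transcendental.KZ.of rL ∈ Literature.NumberTheory.Transcendental.KZ.relations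

/-- Verbatim copy of `Lines/NeronTorsionComplex.lean :: NeronTorsionComplexPoints` (THE RUNG). -/
def NeronTorsionComplexPoints : Prop := ∀ nonReal : Bool, NeronTorsionPointSector nonReal

/-- Member `false` is the floor's tied crux on the nose. -/
theorem false_iff : NeronTorsionPointSector false ↔
    Summit.KontsevichZagierPeriods.KontsevichZagierPeriods.Theses.TorsionLogs.NeronTorsionSector :=
  Iff.rfl

/-- **F3 witness (named):** the floor (seed `stub_assembly`, through the landed bookkeeping) is member `false`. -/
theorem rung_false : NeronTorsionPointSector false :=
  false_iff.mpr (NeronTorsionSector_of_primitiveChain stub_assembly)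

/-- **F3 witness in the brief's literal shape** `example : Rung <floor parameters> := by simpa [Rung] using <seed>`. -/
example : NeronTorsionPointSector false := by
  simpa [NeronTorsionPointSector] using
    (NeronTorsionSector_of_primitiveChain stub_assembly :
      Summit.KontsevichZagierPeriods.KontsevichZagierPeriods.Theses.TorsionLogs.NeronTorsionSector)

/-- The rung restricted to the floor's index is exactly what the floor proves:
`Rung ↔ (real member ∧ non-real member)` with the first conjunct discharged. -/
theorem rung_iff_nonReal : NeronTorsionComplexPoints ↔ NeronTorsionPointSector true :=
  ⟨fun h => h true, fun h b => by cases b <;> [exact rung_false; exact h]⟩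

end Summit.KontsevichZagierPeriods.KontsevichZagierPeriods.Cruxes.TorsionSectorComplete.NeronTorsionComplex.Special

end
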